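import Summits.Ventures.CertifiedManyBodySolver.Downfold.EmeryBoxesHg1201P10MoreePPThermalCapRetiltMarkovBoxp1
import Summits.Ventures.CertifiedManyBodySolver.Downfold.EmeryBoxesHg1201P10MoreePPThermalFloorAtlasWord
import Summits.Ventures.CertifiedManyBodySolver.Downfold.EmeryThermalAtomicFloor
import HarnessLib

/-!
# HIGH-TEMPERATURE-CLOSING `T > 0` WINDOW on HgBa2CuO4 (M19) @10 GPa U-SLICE «Morée PP δ0» (8.51, 5.35) — `emeryBoxHg1201P10MoreePP` (router/EMERY-FLOOR-ORDERS row 16): the ATOMIC-LIMIT floor (full entropy) ∨ the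
# family floor, against the re-tilted cap — both sides meet at `6 log 2` as β → 0

Venture CertifiedManyBodySolver, cell `pub/hubbard-downfold` (S1 = ROUTER) × crew hubbard-fast S2 (ii) × (iv) «T > 0 × multi-band» (D-0096 (ii)); seat hubbard-downfold-mod-4
(S1/S2 Emery seam, g17). Namespace `Summit.Ventures.CertifiedManyBodySolver.Downfold`. DOOR: `EmeryThermalAtomicFloor` (`holdsOn_emeryCellPressureAtomicFloor`: Peierls on the
whole occupation basis of the `Cu₄O₈` block, site-wise factorisation; the one-site function is the tree's `atomicPartitionFnReal β U μ`). INPUTS BY NAME: the family floor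
`emeryBoxHg1201P10MoreePP_pressureFloorFam_m53o5` (`EmeryBoxesHg1201P10MoreePPThermalFloorAtlasWord`; C = (-170.196437, -170.540795)), the cap `emeryBoxHg1201P10MoreePP_pressureCap_m53o5_retilt` (`EmeryBoxesHg1201P10MoreePPThermalCapRetiltMarkovBoxp1`; `6 log 2 + 48.3115·β`; flat word 50.7115).
ATOMIC DATA: Cu at `μ_d = −(εp + Δ_hi) = 19/2`, `U_d,hi = 851/100`; O at `μ_p = −εp = 53/5`, `U_p,hi = 107/20` ⇒ classical slope 42.1900·β (family slope 42.6352; cap 48.3115).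
RESULT: **`emeryBoxHg1201P10MoreePP_pressureWindowHighT_m53o5`**: `max(atomic, family) ≤ P_cell ≤ 6 log 2 + 48.3115·β` on the whole box, every β ≥ 0; width → 0 as β → 0 (both sides `6 log 2`,
`emeryBoxHg1201P10MoreePP_pressure_beta_zero_m53o5`); crossover β* ≈ 0.997 (T* ≈ 11636 K) below which the atomic floor is the better floor [float].

Everything PROVED (0 sorry); no definition. HONEST FRAMING: CERTIFIED inequalities on a SCREENING/EXTRAPOLATED-grade object; the atomic floor ignores hopping (its slope sits
0.4452 below the family floor's), so at physical temperatures (β ≈ 20–40 eV⁻¹) the family floor still decides and thermal scales are NOT resolved there; what is new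
is the correct INFINITE-TEMPERATURE closure of the window and a certified high-T regime (β ≲ β*) with width `≈ 6.1215·β`; grand-canonical at the stated level; no phase word;
no router number moves. WHAT-THIS-IS-NOT: a new certificate (pure algebra on landed objects; zero kit).
-/

noncomputable section

namespace Summit.Ventures.CertifiedManyBodySolver.Downfold

open NonemptyInterval Matrix Finset Literature.Probability.LatticeModels
open Literature.MathematicalPhysics.QuantumLattice Literature.Computation.Certificates
open Summit.Ventures.CertifiedManyBodySolver.Certificates OccupationCode ClusterLowerBound
open scoped BigOperators ComplexOrder

/-! ## §1 The atomic-limit floor on the box at εp = -53/5 -/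

/-- **ATOMIC-LIMIT `T > 0` FLOOR** on the whole `emeryBoxHg1201P10MoreePP`, cuprate signs, level εp = -53/5 (chemical potential 53/5 eV), EVERY β ≥ 0:
`log z₀(β; U_d = 851/100, μ_d = 19/2) + 2·log z₀(β; U_p = 107/20, μ_p = 53/5) ≤ P_cell` with `z₀(β; U, μ) = 1 + 2e^{βμ} + e^{−β(U−2μ)}` (`atomicPartitionFnReal`; Cu at the
box's upper level `εp + Δ_hi = -19/2` and `U_d,hi`, O at `εp` and `U_p,hi`). Value `6 log 2` at β = 0; slope `42.1900·β` as β → ∞ (classical minimum, no hopping).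
[cite: Ruelle1969, §2.5–2.6] [cite: Ueltschi1999, §3] -/
theorem emeryBoxHg1201P10MoreePP_pressureAtomicFloor_m53o5 {β : ℝ} (hβ : 0 ≤ β) :
    HoldsOn (fun p : EmeryCoord → ℝ => Real.log (atomicPartitionFnReal β (851/100 : ℝ) (19/2 : ℝ)) + 2 * Real.log (atomicPartitionFnReal β (107/20 : ℝ) (53/5 : ℝ)) ≤ emeryCellPressure β (emeryLine cuprateSigns (emeryLineCoords (((-53/5 : ℚ)) : ℝ) p))) emeryBoxHg1201P10MoreePP := by
  intro p hp
  have h := holdsOn_emeryCellPressureAtomicFloor (E := emeryBoxHg1201P10MoreePP) (eA := hg1201P10Emery_tpd) (eB := hg1201P10Emery_tpp) (eD := hg1201P10MoreePPEmery_Delta) (eUd := hg1201P10MoreePPEmery_Udd) (eUp := hg1201P10MoreePPEmery_Upp) (-53/5) (by simp [emeryBoxHg1201P10MoreePP, emeryBoxHg1201P10MoreePPSrc, Function.update]) (by simp [emeryBoxHg1201P10MoreePP, emeryBoxHg1201P10MoreePPSrc, Function.update]) (Function.update_self _ _ _) (by simp [emeryBoxHg1201P10MoreePP, emeryBoxHg1201P10MoreePPSrc,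 Function.update]) (by simp [emeryBoxHg1201P10MoreePP, emeryBoxHg1201P10MoreePPSrc, Function.update]) cuprateSigns hβ p hp
  simp only [hg1201P10MoreePPEmery_Delta, hg1201P10MoreePPEmery_Udd, hg1201P10MoreePPEmery_Upp, Entry.encl_ofEnds_snd] at h
  push_cast at h
  norm_num at h ⊢
  exact h

/-! ## §2 The best floor and the HIGH-TEMPERATURE-CLOSING window -/

/-- **BEST `T > 0` FLOOR = max(atomic, family)** on the whole box at εp = -53/5, every β ≥ 0: the atomic floor (full entropy, slope 42.1900) wins for
β < β* ≈ 0.997 (T > 11636 K), the family floor `emeryBoxHg1201P10MoreePP_pressureFloorFam_m53o5` (slope 42.6352, entropy ¼·log 2) for β > β*. [cite: Ruelle1969, §2.5–2.6] [cite: Israel1979, Lemma II.3.1] -/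
theorem emeryBoxHg1201P10MoreePP_pressureFloorBest_m53o5 {β : ℝ} (hβ : 0 ≤ β) :
    HoldsOn (fun p : EmeryCoord → ℝ => max (Real.log (atomicPartitionFnReal β (851/100 : ℝ) (19/2 : ℝ)) + 2 * Real.log (atomicPartitionFnReal β (107/20 : ℝ) (53/5 : ℝ))) (Real.log (Real.exp (-(β * (-170196437/1000000 : ℝ))) + Real.exp (-(β * (-34108159/200000 : ℝ)))) / 4) ≤ emeryCellPressure β (emeryLine cuprateSigns (emeryLineCoords (((-53/5 : ℚ)) : ℝ) p))) emeryBoxHg1201P10MoreePP :=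
  fun p hp => max_le (emeryBoxHg1201P10MoreePP_pressureAtomicFloor_m53o5 hβ p hp) (emeryBoxHg1201P10MoreePP_pressureFloorFam_m53o5 hβ p hp)

/-- **THE HIGH-TEMPERATURE-CLOSING TWO-SIDED `T > 0` WINDOW** (hypothesis-free on both sides) on the whole `emeryBoxHg1201P10MoreePP`, level εp = -53/5, EVERY β ≥ 0:
`max(atomic, family) ≤ P_cell ≤ 6 log 2 + β·966229219/20000000` (cap = `emeryBoxHg1201P10MoreePP_pressureCap_m53o5_retilt`, hubbard-box-p1 re-tilted). BOTH SIDES EQUAL `6 log 2` AT β = 0; the width is `O(β)` for small β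
(slope gap 6.1215 against the atomic floor, 5.6763 against the family floor). Table [float; `T = 11604.5/β` K]:
| β (1/eV) | T (K) | atomic floor | family floor | best floor | cap | width |
|---|---|---|---|---|---|---|
| 0.01 | 1160450 | 4.4220 | 0.5992 | 4.4220 | 4.6420 | 0.2200 |
| 0.1 | 116045 | 7.1111 | 4.4325 | 7.1111 | 8.9900 | 1.8789 |
| 0.5 | 23209 | 22.1657 | 21.4703 | 22.1657 | 28.3146 | 6.1489 |
| 1 | 11604 | 42.7666 | 42.7691 | 42.7691 | 52.4703 | 9.7012 |
| 2 | 5802 | 84.6239 | 85.3721 | 85.3721 | 100.7818 | 15.4097 |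
| 5 | 2321 | 210.9641 | 213.2171 | 213.2171 | 245.7162 | 32.4991 |
| 10 | 1160 | 421.9001 | 426.3599 | 426.3599 | 487.2735 | 60.9136 |
| 20 | 580 | 843.8000 | 852.7042 | 852.7042 | 970.3881 | 117.6839 |
| 40 | 290 | 1687.6000 | 1705.4080 | 1705.4080 | 1936.6173 | 231.2094 |
[cite: Israel1979, Thm. I.2.4] [cite: Ruelle1969, §2.5–2.6] [cite: Ueltschi1999, §3] -/
theorem emeryBoxHg1201P10MoreePP_pressureWindowHighT_m53o5 {β : ℝ} (hβ : 0 ≤ β) :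
    HoldsOn (fun p : EmeryCoord → ℝ =>
      max (Real.log (atomicPartitionFnReal β (851/100 : ℝ) (19/2 : ℝ)) + 2 * Real.log (atomicPartitionFnReal β (107/20 : ℝ) (53/5 : ℝ))) (Real.log (Real.exp (-(β * (-170196437/1000000 : ℝ))) + Real.exp (-(β * (-34108159/200000 : ℝ)))) / 4) ≤ emeryCellPressure β (emeryLine cuprateSigns (emeryLineCoords (((-53/5 : ℚ)) : ℝ) p)) ∧
      emeryCellPressure β (emeryLine cuprateSigns (emeryLineCoords (((-53/5 : ℚ)) : ℝ) p)) ≤ 6 * Real.log 2 + β * (966229219/20000000 : ℝ)) emeryBoxHg1201P10MoreePP :=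
  fun p hp => ⟨emeryBoxHg1201P10MoreePP_pressureFloorBest_m53o5 hβ p hp, by simpa using emeryBoxHg1201P10MoreePP_pressureCap_m53o5_retilt hβ p hp⟩

/-- **At β = 0 the window is a point**: `P_cell(0, ·) = 6 log 2` on the whole box (floor and cap coincide). [cite: Ueltschi1999, §3] -/
theorem emeryBoxHg1201P10MoreePP_pressure_beta_zero_m53o5 :
    HoldsOn (fun p : EmeryCoord → ℝ => emeryCellPressure 0 (emeryLine cuprateSigns (emeryLineCoords (((-53/5 : ℚ)) : ℝ) p)) = 6 * Real.log 2) emeryBoxHg1201P10MoreePP := by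
  intro p hp
  have h := emeryBoxHg1201P10MoreePP_pressureWindowHighT_m53o5 le_rfl p hp
  rw [atomicPartitionFnReal_beta_zero, atomicPartitionFnReal_beta_zero, show (4 : ℝ) = 2 ^ 2 by norm_num, Real.log_pow] at h
  simp only [Nat.cast_ofNat, zero_mul, add_zero] at h
  have h1 := (le_max_left _ _).trans h.1
  linarith [h.2]

end Summit.Ventures.CertifiedManyBodySolver.Downfold

end
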